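import Summits.BirchSwinnertonDyer.BirchSwinnertonDyer.Theses.TwinTransportX9
import Literature.NumberTheory.EllipticCurves.Rank1Residual.X9MuInvariant
import HarnessLib

/-!
# Route `TwinTransportX9` — item `RankZeroBSDpToIMCX9` (LINE 4 support), kernel-checked

`Summit.BirchSwinnertonDyer.BirchSwinnertonDyer.Theses.TwinTransportX9.RankZeroBSDpToIMCX9` is PROVED:
from BCS 2025 Thm. 1.1.2 (a), Greenberg 1999 Thm. 4.1, the period unit, modularity (parametrisation,
entire `L`) and Gross–Zagier–Kolyvagin — all as NAMED-FACT hypotheses, exactly the item's antecedents — at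
every X9 pair `(E', p)` of analytic rank `0` with `p ∤ #Ш(E') · #E'(ℚ)_tors` and
`v_p(L(E',1)/Ω_{E'}) = v_p Tam(E')` the cyclotomic main conjecture holds integrally: `X` is torsion and
`char X = (g)` with `ι g = L_p(f, α)` EXACTLY.

Proof (the Tamagawa CANCELLATION of the line): BCS (a) gives `ι g = p^k · L_p(f, α)`; the tree's rank-`0`
valuation chain with an exponent, `Rank1Residual.padicValRat_lvalue_add_exponent_of_charIdeal_eq`
(Greenberg's identity + Mazur–Tate–Teitelbaum interpolation; `#Ẽ(𝔽_p)²` and `(1 − α⁻¹)²` cancel inside),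
reads `v_p(L(E',1)/Ω) + k = v_p #Ш + v_p Tam − 2 v_p #tors`; the twin conditions make this
`v_p Tam + k = v_p Tam`, so `k = 0`.  No `μ`, no unit-coefficient certificate (contrast the tree's
`X9.mu_eq_zero_of_bsdp`, which needs `hcert`).  The period ratio `ϖ = u⁻¹` comes from
`realPeriodRat_eq_unit_mul_plusPeriod` and is a `p`-adic unit (`Rank1Residual.norm_periodRatio_eq_one`).

THEOREMS ONLY (no definition, no named fact, no `sorry`); nothing booked — the six published inputs are
hypotheses; no summit or leaf is proved (ideator seat bsd-idea-2 g2).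
-/

set_option linter.dupNamespace false
set_option autoImplicit false

noncomputable section

open scoped Classical

open WeierstrassCurve Literature.NumberTheory.EllipticCurves Literature.NumberTheory.EllipticCurves.ModularForms
  Summit.BirchSwinnertonDyer.BirchSwinnertonDyer.Rank1Residual

open Literature.NumberTheory.EllipticCurves.Rank1Residual (norm_periodRatio_eq_one
  padicValRat_lvalue_add_exponent_of_charIdeal_eq)

open Summit.BirchSwinnertonDyer.BirchSwinnertonDyer.Theses.TwinTransportX9 (RankZeroBSDpToIMCX9)

namespace Summit.BirchSwinnertonDyer.BirchSwinnertonDyer.Rank1Residual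

namespace TwinTransport

/-- **Rank-`0` `BSD_p`-shape data ⇒ integral cyclotomic IMC on X9** — the route item
`RankZeroBSDpToIMCX9`, proved. -/
theorem twinTransportX9_rankZeroBSDpToIMC : RankZeroBSDpToIMCX9 := by
  intro hBCSa hGr hPer hmodP hmodL hGZK W' _ _ p _ hX9 htwin κ γ N _ f hκ hγ hγ' hf D
  obtain ⟨hr, hSha, htor, q, hq, hvq⟩ := htwin
  obtain ⟨-, h5, hgood, hord, hirr, -⟩ := hX9
  have hpP : p.Prime := Fact.out
  have hp2 : p ≠ 2 := by omega
  -- the BCS datum `(g, k)`; it suffices to show `k = 0`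
  obtain ⟨hX, g, k, hchar, hιg⟩ := hBCSa W' p κ γ f h5 hgood hord hirr hκ hγ hγ' hf D
  suffices hk : k = 0 by
    subst hk
    exact ⟨hX, g, hchar, by simpa using hιg⟩
  have hL : W'.entireLFunction 1 ≠ 0 := (W'.analyticRank_eq_zero_iff_holds (hmodL W')).1 hr
  have hfin : Finite W'.sha := (hGZK W' (by omega)).2
  -- the period ratio `ϖ = u⁻¹`, a `p`-adic unit
  obtain ⟨u, hu1, huΩ⟩ := hPer W' p h5 hgood hirr f hf
  have hu0 : u ≠ 0 := by
    rintro rfl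
    simp at hu1
  have hϖeq : ((u⁻¹ : ℚ) : ℝ) * W'.realPeriodRat = plusPeriod f := by
    rw [huΩ]
    have hu0' : (u : ℝ) ≠ 0 := by exact_mod_cast hu0
    push_cast
    field_simp
  have hϖnorm : ‖((u⁻¹ : ℚ) : ℚ_[p])‖ = 1 :=
    norm_periodRatio_eq_one hPer W' p h5 hgood hirr f hf (u⁻¹) hϖeq
  have hϖv : padicValRat p (u⁻¹ : ℚ) = 0 := by
    have hne : (((u⁻¹ : ℚ)) : ℚ_[p]) ≠ 0 := by exact_mod_cast inv_ne_zero hu0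
    have h := Padic.norm_eq_zpow_neg_valuation hne
    rw [hϖnorm, Padic.valuation_ratCast] at h
    have hp1 : (1 : ℝ) < p := by exact_mod_cast hpP.one_lt
    have h0 : (p : ℝ) ^ (0 : ℤ) = (p : ℝ) ^ (-padicValRat p (u⁻¹ : ℚ)) := by rw [zpow_zero]; exact h
    have := zpow_right_injective₀ (zero_lt_one.trans hp1) hp1.ne' h0
    omega
  -- the rank-0 valuation chain with exponent `k`
  obtain ⟨t, htq, hval⟩ := padicValRat_lvalue_add_exponent_of_charIdeal_eq W' p hgood hord hL hfin
    (hGr W' p hp2 hgood hord) κ γ hκ hγ hγ' f hf (u⁻¹) hϖeq hϖv D hX g k hchar hιg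
  -- `t = q`: at analytic rank 0 the leading coefficient is `L(E', 1)`
  have htq' : ((t : ℚ) : ℂ) = (q : ℂ) := by
    rw [← htq, ← hq, W'.leadingLCoeff_eq_of_analyticRank_eq_zero hr]
  have ht : t = q := by exact_mod_cast htq'
  subst ht
  -- the twin conditions: `v_p #Ш = 0`, `v_p #tors = 0`, `v_p (L/Ω) = v_p Tam`
  have hvS : padicValNat p W'.shaOrder = 0 := padicValNat.eq_zero_of_not_dvd hSha
  have hvT : padicValNat p W'.torsionOrder = 0 := padicValNat.eq_zero_of_not_dvd htor
  rw [hvq, hvS, hvT] at hval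
  push_cast at hval
  omega

/-- The route item, by its fully qualified name. -/
theorem rankZeroBSDpToIMCX9_holds :
    Summit.BirchSwinnertonDyer.BirchSwinnertonDyer.Theses.TwinTransportX9.RankZeroBSDpToIMCX9 :=
  twinTransportX9_rankZeroBSDpToIMC

end TwinTransport

end Summit.BirchSwinnertonDyer.BirchSwinnertonDyer.Rank1Residual

end
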